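import Summits.ValiantsHypothesis.ValiantsHypothesis.Theorems.SymPencilSingFiveClassificationDefs
import Summits.ValiantsHypothesis.ValiantsHypothesis.Theorems.SymPencilPerFourJointFamilyTransport
import Summits.ValiantsHypothesis.ValiantsHypothesis.Theorems.SymPencilPerFourCrossKronecker
import Summits.ValiantsHypothesis.ValiantsHypothesis.Theorems.SymPencilPerFourPairingHyperplane
import Summits.ValiantsHypothesis.ValiantsHypothesis.Theorems.SymPencilPerFourLowRankSeven
import Summits.ValiantsHypothesis.ValiantsHypothesis.Theorems.SymPencilPerFourTwoRowsCommonZeroColumn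

/-!
# Route `SymPencil` — the V-side of the size-27 cell `(11, 5, 4)`, PORT of val-idea-18's cascade, leaf R1N tools (T1)/(T1′)
# (`--supports` stmt-ValiantsHypothesis-5674 `SdcSuperquadratic`; verbatim port of §2h (first half) of
# `Cruxes/SdcSuperquadratic/Lines/sing_five_classification.lean` rev 10 (val-idea-18 g5); PORT-PLAN-115.md; rung currency only)

Leaf R1N tools in the normal form «zero row `3`» (memo §6.2): the one-zero-row Hessian reading `second_diff₁`, `sum_sq_eq_Q1`
(`Σ c_k Λ_k(u)² = Q_y(u)`), the MANUFACTURED two-row families at the truncations `trunc_family01/02/12` ((T1): every pair of live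
rows of every element is STAR or BIPARTITE via ✓ `star_or_bipartite_of_sum_sq_swap_rows`), and (T1′) `common_col01/02/12`: if a
live row pair has no pure element then the two rows share a zero column.  (An independent route to (T1) for three-row elements is
✓ `SymPencilPerFourOneRowReadingPairs.sb₁₂/sb₁₃/sb₂₃`.)

Honest framing: [folklore] a verbatim port; `27 ≤ sdc(per₄) ≤ 29` unchanged; the crux `SdcSuperquadratic` and `VP ≠ VNP` untouched; no summit
statement is proved here.  No definitions, no named facts.
-/

noncomputable section

-- single-conjunct layout: Sub = Summit, duplicated namespace component intended
set_option linter.dupNamespace false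

namespace Summit.ValiantsHypothesis.ValiantsHypothesis.Theorems.SymPencilSingFiveClassification

open MvPolynomial Module Matrix
open scoped Polynomial
open Literature.Computability.AlgebraicComplexity
open Summit.ValiantsHypothesis.ValiantsHypothesis.Theorems
open Summit.ValiantsHypothesis.ValiantsHypothesis.Theorems.SymPencilSingSixClassification
open Summit.ValiantsHypothesis.ValiantsHypothesis.Theorems.SymPencilPerFourJointFamilyTransport

variable {K : Type*} [Field K]

/-- **Lemma TwoRows, (T1′) form** (the workfile's `twoRows_common_col`, here from ✓
`SymPencilPerFourTwoRowsCommonZeroColumn.common_zero_coord`): a `5`-dimensional `W` supported on the rows `p, q` with a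
per-direction family of `≤ 4` squares at every element has a common zero column of its two live rows. [folklore] -/
theorem twoRows_common_col [CharZero K] (W : Submodule K (Fin 4 × Fin 4 → K))
    (h5 : finrank K W = 5) {p q : Fin 4} (hpq : p ≠ q)
    (hsupp : ∀ y ∈ W, ∀ i j : Fin 4, i ≠ p → i ≠ q → y (i, j) = 0)
    (hP : ∀ y ∈ W, ∃ (c : Fin 4 → K) (Λ : Fin 4 → ((Fin 4 × Fin 4 → K) →ₗ[K] K)),
      ∀ u : Fin 4 × Fin 4 → K, ∃ e₀ e₁ : K, ∀ s : K,
        eval (u + s • y) (perPoly (Fin 4) K) = e₀ + s * e₁ + s ^ 2 * ∑ k, c k * (Λ k u) ^ 2) :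
    ∃ m : Fin 4, ∀ y ∈ W, y (p, m) = 0 ∧ y (q, m) = 0 := by
  classical
  let R : (Fin 4 × Fin 4 → K) →ₗ[K] ((Fin 4 → K) × (Fin 4 → K)) := (rowL p).prod (rowL q)
  have hR : ∀ x : Fin 4 × Fin 4 → K, R x = (fun j => x (p, j), fun j => x (q, j)) := fun x => rfl
  have hker : LinearMap.ker (R.comp W.subtype) = ⊥ := by
    refine LinearMap.ker_eq_bot'.2 ?_
    rintro ⟨x, hx⟩ h0
    have h0' : R x = 0 := h0
    rw [hR] at h0'
    have hp0 : ∀ j, x (p, j) = 0 := fun j => by simpa using congrFun (congrArg Prod.fst h0') j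
    have hq0 : ∀ j, x (q, j) = 0 := fun j => by simpa using congrFun (congrArg Prod.snd h0') j
    apply Subtype.ext
    funext ⟨i, j⟩
    by_cases hip : i = p
    · rw [hip]; exact hp0 j
    by_cases hiq : i = q
    · rw [hiq]; exact hq0 j
    exact hsupp x hx i j hip hiq
  have hU5 : 5 ≤ finrank K (W.map R) := by
    have h1 := LinearMap.finrank_range_add_finrank_ker (R.comp W.subtype)
    rw [hker, finrank_bot, add_zero, LinearMap.range_comp, Submodule.range_subtype] at h1
    rw [h1, h5]
  obtain ⟨m, hm⟩ := SymPencilPerFourTwoRowsCommonZeroColumn.common_zero_coord (W.map R) hU5 (by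
    rintro _ ⟨y, hy, rfl⟩
    obtain ⟨c, Λ, h⟩ := hP y hy
    have key := SymPencilPerFourTwoRowCorankTwo.star_or_bipartite_of_sum_sq_swap_rows (ι := Fin 4) (by simp) hpq y
      (hsupp y hy) c Λ h
    rw [hR]
    exact key)
  refine ⟨m, fun x hx => ⟨?_, ?_⟩⟩
  · have := (hm (R x) ⟨x, hx, rfl⟩).1
    rw [hR] at this; exact this
  · have := (hm (R x) ⟨x, hx, rfl⟩).2
    rw [hR] at this; exact this


/-- **Second finite difference of `per₄` along a one-zero-row direction**:
`per(u + y) + per(u − y) − 2 per(u) = 2 Q_y(u)` (the quartic term is `per y = 0`). [folklore] -/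
theorem second_diff₁ (y : Fin 4 × Fin 4 → K) (hrow : ∀ m, y (3, m) = 0) (u : Fin 4 × Fin 4 → K) :
    eval (u + y) (perPoly (Fin 4) K) + eval (u - y) (perPoly (Fin 4) K) -
      2 * eval u (perPoly (Fin 4) K) = 2 * Q1 y u := by
  have h30 := hrow 0; have h31 := hrow 1; have h32 := hrow 2; have h33 := hrow 3
  simp only [eval_perPoly, Matrix.permanent_fin_four_row, Matrix.of_apply, Pi.add_apply,
    Pi.sub_apply, h30, h31, h32, h33, add_zero, sub_zero, Q1, xf]
  ring

/-- **The one-zero-row Hessian reading**: a per-direction family of squares at `y` represents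
exactly `Q_y`. [folklore] -/
theorem sum_sq_eq_Q1 [CharZero K] (y : Fin 4 × Fin 4 → K) (hrow : ∀ m, y (3, m) = 0)
    {ι : Type*} [Fintype ι] (c : ι → K) (Λ : ι → ((Fin 4 × Fin 4 → K) →ₗ[K] K))
    (h : ∀ u : Fin 4 × Fin 4 → K, ∃ e₀ e₁ : K, ∀ s : K,
      eval (u + s • y) (perPoly (Fin 4) K) = e₀ + s * e₁ + s ^ 2 * ∑ k, c k * (Λ k u) ^ 2)
    (u : Fin 4 × Fin 4 → K) : ∑ k, c k * (Λ k u) ^ 2 = Q1 y u := by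
  obtain ⟨e₀, e₁, he⟩ := h u
  have h0 := he 0
  have h1 := he 1
  have h1' := he (-1)
  rw [zero_smul, add_zero] at h0
  rw [one_smul] at h1
  rw [neg_one_smul, ← sub_eq_add_neg] at h1'
  have hd := second_diff₁ y hrow u
  have h2 : (2 : K) * ∑ k, c k * (Λ k u) ^ 2 = 2 * Q1 y u := by
    linear_combination hd - h1 - h1' + 2 * h0
  exact (mul_right_inj' two_ne_zero).1 h2

/-- The MANUFACTURED family at the two-row truncation to the rows `0, 1`: with
`Σ c_k Λ_k(u)² = Q_y(u)`, the truncation carries the family `Λ_k ∘ zeroRows 0 1`. [folklore] -/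
theorem trunc_family01 [CharZero K] (y : Fin 4 × Fin 4 → K) (_hrow : ∀ m, y (3, m) = 0)
    (c : Fin 4 → K) (Λ : Fin 4 → ((Fin 4 × Fin 4 → K) →ₗ[K] K))
    (hQ : ∀ u : Fin 4 × Fin 4 → K, ∑ k, c k * (Λ k u) ^ 2 = Q1 y u) :
    ∀ u : Fin 4 × Fin 4 → K, ∃ e₀ e₁ : K, ∀ s : K,
      eval (u + s • trunc 0 1 y) (perPoly (Fin 4) K) =
        e₀ + s * e₁ + s ^ 2 * ∑ k, c k * (((Λ k).comp (zeroRows 0 1)) u) ^ 2 := by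
  intro u
  refine ⟨eval u (perPoly (Fin 4) K),
    (eval (u + trunc 0 1 y) (perPoly (Fin 4) K) - eval (u - trunc 0 1 y) (perPoly (Fin 4) K)) / 2,
    fun s => ?_⟩
  simp only [LinearMap.comp_apply]
  rw [hQ (zeroRows 0 1 u)]
  have key : 2 * eval (u + s • trunc 0 1 y) (perPoly (Fin 4) K) =
      2 * eval u (perPoly (Fin 4) K) +
        s * (eval (u + trunc 0 1 y) (perPoly (Fin 4) K) - eval (u - trunc 0 1 y) (perPoly (Fin 4) K)) +
        2 * s ^ 2 * Q1 y (zeroRows 0 1 u) := by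
    simp only [eval_perPoly, Matrix.permanent_fin_four_row, Matrix.of_apply, Pi.add_apply,
      Pi.sub_apply, Pi.smul_apply, smul_eq_mul, trunc, zeroRows_apply, Q1, xf]
    simp
    ring
  have h2 : (2 : K) ≠ 0 := two_ne_zero
  field_simp
  linear_combination key

/-- The MANUFACTURED family at the two-row truncation to the rows `0, 2`: with
`Σ c_k Λ_k(u)² = Q_y(u)`, the truncation carries the family `Λ_k ∘ zeroRows 0 2`. [folklore] -/
theorem trunc_family02 [CharZero K] (y : Fin 4 × Fin 4 → K) (_hrow : ∀ m, y (3, m) = 0)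
    (c : Fin 4 → K) (Λ : Fin 4 → ((Fin 4 × Fin 4 → K) →ₗ[K] K))
    (hQ : ∀ u : Fin 4 × Fin 4 → K, ∑ k, c k * (Λ k u) ^ 2 = Q1 y u) :
    ∀ u : Fin 4 × Fin 4 → K, ∃ e₀ e₁ : K, ∀ s : K,
      eval (u + s • trunc 0 2 y) (perPoly (Fin 4) K) =
        e₀ + s * e₁ + s ^ 2 * ∑ k, c k * (((Λ k).comp (zeroRows 0 2)) u) ^ 2 := by
  intro u
  refine ⟨eval u (perPoly (Fin 4) K),
    (eval (u + trunc 0 2 y) (perPoly (Fin 4) K) - eval (u - trunc 0 2 y) (perPoly (Fin 4) K)) / 2,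
    fun s => ?_⟩
  simp only [LinearMap.comp_apply]
  rw [hQ (zeroRows 0 2 u)]
  have key : 2 * eval (u + s • trunc 0 2 y) (perPoly (Fin 4) K) =
      2 * eval u (perPoly (Fin 4) K) +
        s * (eval (u + trunc 0 2 y) (perPoly (Fin 4) K) - eval (u - trunc 0 2 y) (perPoly (Fin 4) K)) +
        2 * s ^ 2 * Q1 y (zeroRows 0 2 u) := by
    simp only [eval_perPoly, Matrix.permanent_fin_four_row, Matrix.of_apply, Pi.add_apply,
      Pi.sub_apply, Pi.smul_apply, smul_eq_mul, trunc, zeroRows_apply, Q1, xf]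
    simp
    ring
  have h2 : (2 : K) ≠ 0 := two_ne_zero
  field_simp
  linear_combination key

/-- The MANUFACTURED family at the two-row truncation to the rows `1, 2`: with
`Σ c_k Λ_k(u)² = Q_y(u)`, the truncation carries the family `Λ_k ∘ zeroRows 1 2`. [folklore] -/
theorem trunc_family12 [CharZero K] (y : Fin 4 × Fin 4 → K) (_hrow : ∀ m, y (3, m) = 0)
    (c : Fin 4 → K) (Λ : Fin 4 → ((Fin 4 × Fin 4 → K) →ₗ[K] K))
    (hQ : ∀ u : Fin 4 × Fin 4 → K, ∑ k, c k * (Λ k u) ^ 2 = Q1 y u) :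
    ∀ u : Fin 4 × Fin 4 → K, ∃ e₀ e₁ : K, ∀ s : K,
      eval (u + s • trunc 1 2 y) (perPoly (Fin 4) K) =
        e₀ + s * e₁ + s ^ 2 * ∑ k, c k * (((Λ k).comp (zeroRows 1 2)) u) ^ 2 := by
  intro u
  refine ⟨eval u (perPoly (Fin 4) K),
    (eval (u + trunc 1 2 y) (perPoly (Fin 4) K) - eval (u - trunc 1 2 y) (perPoly (Fin 4) K)) / 2,
    fun s => ?_⟩
  simp only [LinearMap.comp_apply]
  rw [hQ (zeroRows 1 2 u)]
  have key : 2 * eval (u + s • trunc 1 2 y) (perPoly (Fin 4) K) =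
      2 * eval u (perPoly (Fin 4) K) +
        s * (eval (u + trunc 1 2 y) (perPoly (Fin 4) K) - eval (u - trunc 1 2 y) (perPoly (Fin 4) K)) +
        2 * s ^ 2 * Q1 y (zeroRows 1 2 u) := by
    simp only [eval_perPoly, Matrix.permanent_fin_four_row, Matrix.of_apply, Pi.add_apply,
      Pi.sub_apply, Pi.smul_apply, smul_eq_mul, trunc, zeroRows_apply, Q1, xf]
    simp
    ring
  have h2 : (2 : K) ≠ 0 := two_ne_zero
  field_simp
  linear_combination key

/-- **(T1′) for the rows `0, 1`**: if `W` (row `3` zero, per-direction families) has no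
non-zero element supported outside the rows `0, 1`, then the rows `0, 1` of `W` have … (memo). [folklore] -/
theorem common_col01 [CharZero K] (W : Submodule K (Fin 4 × Fin 4 → K)) (h5 : finrank K W = 5)
    (hrow : ∀ x ∈ W, ∀ j : Fin 4, x (3, j) = 0) (hP : PerDirFour W)
    (hinj : ∀ x ∈ W, (∀ j : Fin 4, x (0, j) = 0) → (∀ j : Fin 4, x (1, j) = 0) → x = 0) :
    ∃ m : Fin 4, ∀ y ∈ W, y (0, m) = 0 ∧ y (1, m) = 0 := by
  set W' : Submodule K (Fin 4 × Fin 4 → K) := W.map (truncL 0 1) with hW'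
  have hker : ∀ x ∈ W, truncL (K := K) 0 1 x = 0 → x = 0 := by
    intro x hx h0
    have h := fun i j => congr_fun h0 ((i : Fin 4), (j : Fin 4))
    refine hinj x hx (fun j => ?_) (fun j => ?_)
    · simpa [truncL_apply, trunc] using h 0 j
    · simpa [truncL_apply, trunc] using h 1 j
  have h5' : finrank K W' = 5 := by
    have hinj' : Function.Injective ((truncL (K := K) 0 1).comp W.subtype) := by
      rw [← LinearMap.ker_eq_bot, LinearMap.ker_eq_bot']
      rintro ⟨x, hx⟩ h0
      exact Subtype.ext (hker x hx h0)
    have h := LinearMap.finrank_range_of_inj hinj'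
    rw [LinearMap.range_comp, Submodule.range_subtype] at h
    rw [hW', h]
    exact h5
  have hsupp : ∀ y ∈ W', ∀ i j : Fin 4, i ≠ 0 → i ≠ 1 → y (i, j) = 0 := by
    rintro _ ⟨x, -, rfl⟩ i j hi0 hi1
    exact trunc_supp 0 1 x i j hi0 hi1
  have hP' : ∀ y ∈ W', ∃ (c : Fin 4 → K) (Λ : Fin 4 → ((Fin 4 × Fin 4 → K) →ₗ[K] K)),
      ∀ u : Fin 4 × Fin 4 → K, ∃ e₀ e₁ : K, ∀ s : K,
        eval (u + s • y) (perPoly (Fin 4) K) = e₀ + s * e₁ + s ^ 2 * ∑ k, c k * (Λ k u) ^ 2 := by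
    rintro _ ⟨x, hx, rfl⟩
    obtain ⟨c, Λ, h⟩ := hP x hx
    exact ⟨c, fun k => (Λ k).comp (zeroRows 0 1),
      trunc_family01 x (hrow x hx) c Λ (sum_sq_eq_Q1 x (hrow x hx) c Λ h)⟩
  obtain ⟨m, hm⟩ := twoRows_common_col W' h5' (p := 0) (q := 1) (by decide) hsupp hP'
  refine ⟨m, fun y hy => ?_⟩
  have h := hm (truncL 0 1 y) (Submodule.mem_map_of_mem hy)
  simpa [truncL_apply, trunc] using h

/-- **(T1′) for the rows `0, 2`**: if `W` (row `3` zero, per-direction families) has no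
non-zero element supported outside the rows `0, 2`, then the rows `0, 2` of `W` have … (memo). [folklore] -/
theorem common_col02 [CharZero K] (W : Submodule K (Fin 4 × Fin 4 → K)) (h5 : finrank K W = 5)
    (hrow : ∀ x ∈ W, ∀ j : Fin 4, x (3, j) = 0) (hP : PerDirFour W)
    (hinj : ∀ x ∈ W, (∀ j : Fin 4, x (0, j) = 0) → (∀ j : Fin 4, x (2, j) = 0) → x = 0) :
    ∃ m : Fin 4, ∀ y ∈ W, y (0, m) = 0 ∧ y (2, m) = 0 := by
  set W' : Submodule K (Fin 4 × Fin 4 → K) := W.map (truncL 0 2) with hW'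
  have hker : ∀ x ∈ W, truncL (K := K) 0 2 x = 0 → x = 0 := by
    intro x hx h0
    have h := fun i j => congr_fun h0 ((i : Fin 4), (j : Fin 4))
    refine hinj x hx (fun j => ?_) (fun j => ?_)
    · simpa [truncL_apply, trunc] using h 0 j
    · simpa [truncL_apply, trunc] using h 2 j
  have h5' : finrank K W' = 5 := by
    have hinj' : Function.Injective ((truncL (K := K) 0 2).comp W.subtype) := by
      rw [← LinearMap.ker_eq_bot, LinearMap.ker_eq_bot']
      rintro ⟨x, hx⟩ h0
      exact Subtype.ext (hker x hx h0)
    have h := LinearMap.finrank_range_of_inj hinj'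
    rw [LinearMap.range_comp, Submodule.range_subtype] at h
    rw [hW', h]
    exact h5
  have hsupp : ∀ y ∈ W', ∀ i j : Fin 4, i ≠ 0 → i ≠ 2 → y (i, j) = 0 := by
    rintro _ ⟨x, -, rfl⟩ i j hi0 hi1
    exact trunc_supp 0 2 x i j hi0 hi1
  have hP' : ∀ y ∈ W', ∃ (c : Fin 4 → K) (Λ : Fin 4 → ((Fin 4 × Fin 4 → K) →ₗ[K] K)),
      ∀ u : Fin 4 × Fin 4 → K, ∃ e₀ e₁ : K, ∀ s : K,
        eval (u + s • y) (perPoly (Fin 4) K) = e₀ + s * e₁ + s ^ 2 * ∑ k, c k * (Λ k u) ^ 2 := by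
    rintro _ ⟨x, hx, rfl⟩
    obtain ⟨c, Λ, h⟩ := hP x hx
    exact ⟨c, fun k => (Λ k).comp (zeroRows 0 2),
      trunc_family02 x (hrow x hx) c Λ (sum_sq_eq_Q1 x (hrow x hx) c Λ h)⟩
  obtain ⟨m, hm⟩ := twoRows_common_col W' h5' (p := 0) (q := 2) (by decide) hsupp hP'
  refine ⟨m, fun y hy => ?_⟩
  have h := hm (truncL 0 2 y) (Submodule.mem_map_of_mem hy)
  simpa [truncL_apply, trunc] using h

/-- **(T1′) for the rows `1, 2`**: if `W` (row `3` zero, per-direction families) has no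
non-zero element supported outside the rows `1, 2`, then the rows `1, 2` of `W` have … (memo). [folklore] -/
theorem common_col12 [CharZero K] (W : Submodule K (Fin 4 × Fin 4 → K)) (h5 : finrank K W = 5)
    (hrow : ∀ x ∈ W, ∀ j : Fin 4, x (3, j) = 0) (hP : PerDirFour W)
    (hinj : ∀ x ∈ W, (∀ j : Fin 4, x (1, j) = 0) → (∀ j : Fin 4, x (2, j) = 0) → x = 0) :
    ∃ m : Fin 4, ∀ y ∈ W, y (1, m) = 0 ∧ y (2, m) = 0 := by
  set W' : Submodule K (Fin 4 × Fin 4 → K) := W.map (truncL 1 2) with hW'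
  have hker : ∀ x ∈ W, truncL (K := K) 1 2 x = 0 → x = 0 := by
    intro x hx h0
    have h := fun i j => congr_fun h0 ((i : Fin 4), (j : Fin 4))
    refine hinj x hx (fun j => ?_) (fun j => ?_)
    · simpa [truncL_apply, trunc] using h 1 j
    · simpa [truncL_apply, trunc] using h 2 j
  have h5' : finrank K W' = 5 := by
    have hinj' : Function.Injective ((truncL (K := K) 1 2).comp W.subtype) := by
      rw [← LinearMap.ker_eq_bot, LinearMap.ker_eq_bot']
      rintro ⟨x, hx⟩ h0
      exact Subtype.ext (hker x hx h0)
    have h := LinearMap.finrank_range_of_inj hinj'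
    rw [LinearMap.range_comp, Submodule.range_subtype] at h
    rw [hW', h]
    exact h5
  have hsupp : ∀ y ∈ W', ∀ i j : Fin 4, i ≠ 1 → i ≠ 2 → y (i, j) = 0 := by
    rintro _ ⟨x, -, rfl⟩ i j hi0 hi1
    exact trunc_supp 1 2 x i j hi0 hi1
  have hP' : ∀ y ∈ W', ∃ (c : Fin 4 → K) (Λ : Fin 4 → ((Fin 4 × Fin 4 → K) →ₗ[K] K)),
      ∀ u : Fin 4 × Fin 4 → K, ∃ e₀ e₁ : K, ∀ s : K,
        eval (u + s • y) (perPoly (Fin 4) K) = e₀ + s * e₁ + s ^ 2 * ∑ k, c k * (Λ k u) ^ 2 := by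
    rintro _ ⟨x, hx, rfl⟩
    obtain ⟨c, Λ, h⟩ := hP x hx
    exact ⟨c, fun k => (Λ k).comp (zeroRows 1 2),
      trunc_family12 x (hrow x hx) c Λ (sum_sq_eq_Q1 x (hrow x hx) c Λ h)⟩
  obtain ⟨m, hm⟩ := twoRows_common_col W' h5' (p := 1) (q := 2) (by decide) hsupp hP'
  refine ⟨m, fun y hy => ?_⟩
  have h := hm (truncL 1 2 y) (Submodule.mem_map_of_mem hy)
  simpa [truncL_apply, trunc] using h

end Summit.ValiantsHypothesis.ValiantsHypothesis.Theorems.SymPencilSingFiveClassification
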